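import Mathlib.Data.Rat.Defs
import Mathlib.Data.Finset.Insert
import Mathlib.Algebra.Order.Field.Rat
import Mathlib.Tactic.Linarith
import Mathlib.Tactic.NormNum
import Mathlib.Tactic.FinCases
import Mathlib.Tactic.Positivity
import Mathlib.Tactic.Ring
import HarnessLib

/-!
# Interval arithmetic on the open rate interval `1/30 < r < 1/28`, `p = 5` (T36)

INSTRUMENT, NOT a resolution theorem: the exact rational side-arithmetic of THEOREM-FS eng1-g35 §12
((O3′)_ρ(5), LQ₃(5), F-DENSE_ρ(5) on the open interval `(1/30, 1/28)`; CARVER task T36) for ENGINE 1's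
polynomial weighted-centre toy model `W(f)`.  Genuine weights (value `1`); the legal menu at `p = 5` is
the dense range `(0, 1/5]` together with the five `U`-points `{5/24, 2/9, 1/4, 1/3, 1/2}`
(N, N′, W, M, V); `r` is the rate, the least classes weigh `3r` (`j* = 3`) and `4r` (`Z`, `j** = 4`),
`K₁` weighs `1 − 20r`, `x̂ := 1 − 24r`.

Contents (every item a `norm_num` / `linarith` fact over `ℚ` under `1/30 < r < 1/28`):
* (i) legal pure degrees: `jr` is dense-legal iff `1 ≤ j ≤ 5`; `jr ∈ U` iff `j = 6 ∧ r = 5/144`;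
* (ii) pins of weight `1 − 20r` in parts `≥ 4r`: no triples (`12r > 1 − 20r`), no `U · x` pair, no `zz′`
  (`8r < 1 − 20r`);
* (iii) emitter legality: `(4 + a)r` dense-legal (`a ≥ 1`) iff `a = 1`, and `(4 + a)r ∈ U` iff
  `a = 2 ∧ r = 5/144` (AUDIT NOTE: the `U`-case is absent from the emitter line of FS §12.2, harmless
  there exactly because a slot of weight `6r` is a pure class of degree `6`, excluded by hypothesis);
  the special points `x̂ + r ≤ 1/5 ↔ r ≥ 4/115`, `x̂ + r = 2/9 ↔ r = 7/207`, `= 5/24 ↔ r = 19/552`,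
  `x̂ + 5r = 1/3 ↔ r = 2/57`, the `N′(2;·)·W(3;·)` pair point `r = 19/540`, `x_V + r ≤ 1/5 ↔ r ≥ 1/30`,
  and the sorted list of special points inside the interval;
* (iv) N_E applicability: `x > 4r ⇒ x + r > 1/6`, `5r ≠ 1/5`;
* (v) F-DENSE end: `1 − 25r < 5r`, `6r > 1/5`;
* (vi) hypotheses of the cited lemmas at general `r`: Λ₄ (`2p · 3r > 1`), T9 D (`1/(8r) < 4 < p`),
  degree `6` at `5/144` (`5 · 5/24 > 1`).

NOT a statement about the Abramovich–Temkin–Włodarczyk invariant; nothing here is summit progress;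
AI-written, AI review weaker than expert review.  Reference (context only):
[AbramovichTemkinWlodarczyk2024] §5 (weights of a weighted centre).
-/

namespace Literature.AlgebraicGeometry.Resolution.WeightedBlowup

namespace Interval30

-- The five `U`-points of the `p = 5` legal menu (genuine units) N, N′, W, M, V are written as the
-- literal `({5/24, 2/9, 1/4, 1/3, 1/2} : Finset ℚ)` throughout (= `Window5.U`).

/-! ## (i) Legal pure degrees on the interval -/

/-- Bounds on a degree `j` with `jr = u > 0` on the interval: `28u < j < 30u`. (derived here)
[cite: AbramovichTemkinWlodarczyk2024, §5] -/
theorem degree_bounds_of_mul_eq (r : ℚ) (h1 : 1/30 < r) (h2 : r < 1/28) (j : ℕ) {u : ℚ}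
    (hu : 0 < u) (hjr : (j : ℚ) * r = u) : 28 * u < j ∧ (j : ℚ) < 30 * u := by
  have hj : (0 : ℚ) < j := by
    rcases Nat.eq_zero_or_pos j with rfl | hj
    · simp at hjr; linarith
    · exact_mod_cast hj
  constructor <;> nlinarith [mul_lt_mul_of_pos_left h2 hj, mul_lt_mul_of_pos_left h1 hj]

/-- **(i) dense pure degrees.** On `(1/30, 1/28)`: `0 < jr ≤ 1/5` iff `1 ≤ j ≤ 5` (`5r < 5/28 < 1/5`,
`6r > 1/5`). (derived here) [cite: AbramovichTemkinWlodarczyk2024, §5] -/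
theorem pureDegree_dense_iff (r : ℚ) (h1 : 1/30 < r) (h2 : r < 1/28) (j : ℕ) :
    (0 < (j : ℚ) * r ∧ (j : ℚ) * r ≤ 1/5) ↔ 1 ≤ j ∧ j ≤ 5 := by
  constructor
  · rintro ⟨hpos, hle⟩
    have hj1 : 1 ≤ j := by
      rcases Nat.eq_zero_or_pos j with rfl | hj
      · simp at hpos
      · exact hj
    have hj6 : (j : ℚ) < 6 := by
      by_contra hcon
      rw [not_lt] at hcon
      nlinarith
    have hj6' : j < 6 := by exact_mod_cast hj6
    exact ⟨hj1, by omega⟩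
  · rintro ⟨hj1, hj5⟩
    have hj1' : (1 : ℚ) ≤ j := by exact_mod_cast hj1
    have hj5' : (j : ℚ) ≤ 5 := by exact_mod_cast hj5
    constructor <;> nlinarith

/-- **(i) the `U`-points.** On `(1/30, 1/28)`: `jr ∈ U` iff `j = 6` and `r = 5/144` (`6r = 5/24 = N`);
`7r = W`, `10r = M`, `15r = V` happen only at the excluded end points. (derived here)
[cite: AbramovichTemkinWlodarczyk2024, §5] -/
theorem pureDegree_mem_U_iff (r : ℚ) (h1 : 1/30 < r) (h2 : r < 1/28) (j : ℕ) :
    (j : ℚ) * r ∈ ({5/24, 2/9, 1/4, 1/3, 1/2} : Finset ℚ) ↔ j = 6 ∧ r = 5/144 := by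
  simp only [Finset.mem_insert, Finset.mem_singleton]
  constructor
  · intro h
    rcases h with h | h | h | h | h
    · obtain ⟨ha, hb⟩ := degree_bounds_of_mul_eq r h1 h2 j (by norm_num) h
      have hj : j = 6 := by
        have h5 : 5 < j := by exact_mod_cast (show (5 : ℚ) < j by linarith)
        have h7 : j < 7 := by exact_mod_cast (show (j : ℚ) < 7 by linarith)
        omega
      subst hj
      refine ⟨rfl, ?_⟩
      push_cast at h
      linarith
    · obtain ⟨ha, hb⟩ := degree_bounds_of_mul_eq r h1 h2 j (by norm_num) h
      have h6 : 6 < j := by exact_mod_cast (show (6 : ℚ) < j by linarith)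
      have h7 : j < 7 := by exact_mod_cast (show (j : ℚ) < 7 by linarith)
      omega
    · obtain ⟨ha, hb⟩ := degree_bounds_of_mul_eq r h1 h2 j (by norm_num) h
      have h6 : 7 < j := by exact_mod_cast (show (7 : ℚ) < j by linarith)
      have h7 : j < 8 := by exact_mod_cast (show (j : ℚ) < 8 by linarith)
      omega
    · obtain ⟨ha, hb⟩ := degree_bounds_of_mul_eq r h1 h2 j (by norm_num) h
      have h6 : 9 < j := by exact_mod_cast (show (9 : ℚ) < j by linarith)
      have h7 : j < 10 := by exact_mod_cast (show (j : ℚ) < 10 by linarith)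
      omega
    · obtain ⟨ha, hb⟩ := degree_bounds_of_mul_eq r h1 h2 j (by norm_num) h
      have h6 : 14 < j := by exact_mod_cast (show (14 : ℚ) < j by linarith)
      have h7 : j < 15 := by exact_mod_cast (show (j : ℚ) < 15 by linarith)
      omega
  · rintro ⟨rfl, rfl⟩
    left
    norm_num

/-- Degree `6`: `6r = N = 5/24` iff `r = 5/144`, and `5/144` lies in the interval. (derived here)
[cite: AbramovichTemkinWlodarczyk2024, §5] -/
theorem six_mul_eq_N_iff (r : ℚ) : 6 * r = 5/24 ↔ r = 5/144 := by
  constructor <;> intro h <;> linarith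

/-- Degrees `5, 6, 7, 10, 15` on the interval: `5r < 1/5 < 6r`, `7/30 < 7r < 1/4`, `1/3 < 10r < 5/14`,
`1/2 < 15r < 1`. (derived here) [cite: AbramovichTemkinWlodarczyk2024, §5] -/
theorem pureDegree_numerics (r : ℚ) (h1 : 1/30 < r) (h2 : r < 1/28) :
    5 * r < 1/5 ∧ 1/5 < 6 * r ∧ (7/30 < 7 * r ∧ 7 * r < 1/4) ∧ (1/3 < 10 * r ∧ 10 * r < 5/14) ∧
      (1/2 < 15 * r ∧ 15 * r < 1) := by
  refine ⟨by linarith, by linarith, ⟨by linarith, by linarith⟩, ⟨by linarith, by linarith⟩,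
    ⟨by linarith, by linarith⟩⟩

/-! ## (ii) Pins of `K₁` (weight `1 − 20r`, parts `≥ 4r`) -/

/-- **(ii)** `K₁ = 1 − 20r ∈ (2/7, 1/3)`; no triple of parts `≥ 4r` (`12r > 1 − 20r ⟺ r > 1/32`); no pair
`zz′` of two `Z`-variables (`8r < 1 − 20r ⟺ r < 1/28`). (derived here)
[cite: AbramovichTemkinWlodarczyk2024, §5] -/
theorem K1_numerics (r : ℚ) (h1 : 1/30 < r) (h2 : r < 1/28) :
    (2/7 < 1 - 20 * r ∧ 1 - 20 * r < 1/3) ∧ 1 - 20 * r < 12 * r ∧ 8 * r < 1 - 20 * r :=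
  ⟨⟨by linarith, by linarith⟩, by linarith, by linarith⟩

/-- The exact thresholds: `12r ≤ 1 − 20r ⟺ r ≤ 1/32` and `8r = 1 − 20r ⟺ r = 1/28`. (derived here)
[cite: AbramovichTemkinWlodarczyk2024, §5] -/
theorem K1_thresholds (r : ℚ) :
    (12 * r ≤ 1 - 20 * r ↔ r ≤ 1/32) ∧ (8 * r = 1 - 20 * r ↔ r = 1/28) := by
  refine ⟨⟨fun h => by linarith, fun h => by linarith⟩, ⟨fun h => by linarith, fun h => by linarith⟩⟩

/-- **(ii) no `U · x` pin.** A pair `u + x` with `u ≥ 5/24` (a `U`-slot) and `x > 4r` overshoots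
`1 − 20r` on the interval (`5/24 + 24r > 1 ⟺ r > 19/576`, and `19/576 < 1/30`). (derived here)
[cite: AbramovichTemkinWlodarczyk2024, §5] -/
theorem no_U_pair (r : ℚ) (h1 : 1/30 < r) {u x : ℚ} (hu : 5/24 ≤ u) (hx : 4 * r < x) :
    1 - 20 * r < u + x := by
  linarith

/-- The exact threshold of the `U · x` pair: `5/24 + 4r ≤ 1 − 20r ⟺ r ≤ 19/576` (`< 1/30`).
(derived here) [cite: AbramovichTemkinWlodarczyk2024, §5] -/
theorem U_pair_threshold (r : ℚ) : (5/24 + 4 * r ≤ 1 - 20 * r ↔ r ≤ 19/576) ∧ (19/576 : ℚ) < 1/30 := by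
  refine ⟨⟨fun h => by linarith, fun h => by linarith⟩, by norm_num⟩

/-! ## (iii) Emitter legality -/

/-- **(iii) `Z`-emitters, dense case.** A slot emitting `σ^a · ε_z` weighs `(4 + a)r`; on the interval
this is dense-legal (`0 < (4+a)r ≤ 1/5`) iff `a = 1` (`F̂ = 5r`). (derived here)
[cite: AbramovichTemkinWlodarczyk2024, §5] -/
theorem emitterZ_dense_iff (r : ℚ) (h1 : 1/30 < r) (h2 : r < 1/28) (a : ℕ) (ha : 1 ≤ a) :
    (0 < ((4 : ℚ) + a) * r ∧ ((4 : ℚ) + a) * r ≤ 1/5) ↔ a = 1 := by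
  have key := pureDegree_dense_iff r h1 h2 (4 + a)
  push_cast at key
  rw [key]
  omega

/-- **(iii) `Z`-emitters, `U` case (AUDIT NOTE).** `(4 + a)r ∈ U` on the interval iff `a = 2` and
`r = 5/144` (`6r = N`); `W = 7r`, `V = 14r` need `r = 1/28`.  In FS §12.2 this case is excluded by the
hypothesis "no third pure class" (a slot of weight `6r` is a pure class of degree `6`). (derived here)
[cite: AbramovichTemkinWlodarczyk2024, §5] -/
theorem emitterZ_mem_U_iff (r : ℚ) (h1 : 1/30 < r) (h2 : r < 1/28) (a : ℕ) :
    ((4 : ℚ) + a) * r ∈ ({5/24, 2/9, 1/4, 1/3, 1/2} : Finset ℚ) ↔ a = 2 ∧ r = 5/144 := by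
  have key := pureDegree_mem_U_iff r h1 h2 (4 + a)
  push_cast at key
  rw [key]
  constructor <;> rintro ⟨h, hr⟩ <;> exact ⟨by omega, hr⟩

/-- **(iii) `x̂`-emitters** (`x̂ = 1 − 24r`): `x̂′ := x̂ + r = 1 − 23r` is dense-legal iff `r ≥ 4/115`;
`x̂ + r = N′ = 2/9 ⟺ r = 7/207`; `x̂ + r = N = 5/24 ⟺ r = 19/552`; `x̂ + 5r = 1 − 19r = M = 1/3 ⟺ r = 2/57`
(also the `M(1; x₁x₂)` point: `1/3 − r = 1 − 20r`). (derived here) [cite: AbramovichTemkinWlodarczyk2024, §5] -/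
theorem xhat_emitters (r : ℚ) :
    (1 - 23 * r ≤ 1/5 ↔ 4/115 ≤ r) ∧ (1 - 23 * r = 2/9 ↔ r = 7/207) ∧
      (1 - 23 * r = 5/24 ↔ r = 19/552) ∧ (1 - 19 * r = 1/3 ↔ r = 2/57) ∧
      (1/3 - r = 1 - 20 * r ↔ r = 2/57) := by
  refine ⟨⟨fun h => by linarith, fun h => by linarith⟩, ⟨fun h => by linarith, fun h => by linarith⟩,
    ⟨fun h => by linarith, fun h => by linarith⟩, ⟨fun h => by linarith, fun h => by linarith⟩,
    ⟨fun h => by linarith, fun h => by linarith⟩⟩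

/-- `x̂′ = 1 − 23r` is positive and `< 1/4` on the interval (so it is legal iff dense iff `r ≥ 4/115`,
or one of the two `U`-values `2/9`, `5/24`). (derived here) [cite: AbramovichTemkinWlodarczyk2024, §5] -/
theorem xhat'_range (r : ℚ) (h1 : 1/30 < r) (h2 : r < 1/28) :
    5/28 < 1 - 23 * r ∧ 1 - 23 * r < 7/30 ∧
      (1 - 23 * r ∈ ({5/24, 2/9, 1/4, 1/3, 1/2} : Finset ℚ) ↔ r = 7/207 ∨ r = 19/552) := by
  refine ⟨by linarith, by linarith, ?_⟩
  simp only [Finset.mem_insert, Finset.mem_singleton]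
  constructor
  · rintro (h | h | h | h | h)
    · right; linarith
    · left; linarith
    · exfalso; linarith
    · exfalso; linarith
    · exfalso; linarith
  · rintro (h | h)
    · right; left; linarith
    · left; linarith

/-- **(iii) dense-pair emitters.** `V(10; x)`: `x_V := 1/2 − 10r`, and `x_V + r ≤ 1/5 ⟺ r ≥ 1/30`; the
pair point `N′(2;x₂) · W(3;x₁)`: `(2/9 − 2r) + (1/4 − 3r) = 1 − 20r ⟺ r = 19/540`. (derived here)
[cite: AbramovichTemkinWlodarczyk2024, §5] -/
theorem densePair_emitters (r : ℚ) :
    ((1/2 - 10 * r) + r ≤ 1/5 ↔ 1/30 ≤ r) ∧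
      ((2/9 - 2 * r) + (1/4 - 3 * r) = 1 - 20 * r ↔ r = 19/540) := by
  refine ⟨⟨fun h => by linarith, fun h => by linarith⟩, ⟨fun h => by linarith, fun h => by linarith⟩⟩

/-- The special points of FS §12 inside the interval, sorted:
`1/30 < 7/207 < 19/552 < 5/144 < 4/115 < 2/57 < 19/540 < 1/28`. (derived here)
[cite: AbramovichTemkinWlodarczyk2024, §5] -/
theorem specialPoints_sorted :
    (1/30 : ℚ) < 7/207 ∧ (7/207 : ℚ) < 19/552 ∧ (19/552 : ℚ) < 5/144 ∧ (5/144 : ℚ) < 4/115 ∧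
      (4/115 : ℚ) < 2/57 ∧ (2/57 : ℚ) < 19/540 ∧ (19/540 : ℚ) < 1/28 := by
  norm_num

/-! ## (iv) Applicability of N_E, (v) the F-DENSE end, (vi) cited hypotheses -/

/-- **(iv)** A dense order-one channel `E = x + r` with `x > 4r` has `E > 5r > 1/6` on the interval
(so N_E applies), and `5r ≠ 1/5` (N_E case (a) for `E = F̂`). (derived here)
[cite: AbramovichTemkinWlodarczyk2024, §5] -/
theorem NE_applicable (r : ℚ) (h1 : 1/30 < r) (h2 : r < 1/28) {x : ℚ} (hx : 4 * r < x) :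
    1/6 < x + r ∧ 1/6 < 5 * r ∧ 5 * r ≠ 1/5 := by
  refine ⟨by linarith, by linarith, fun h => by linarith⟩

/-- **(v) F-DENSE end.** `1 − 25r < 5r ⟺ r > 1/30` (holds on the interval) and `6r > 1/5` (no dense
supplier of degree `6`). (derived here) [cite: AbramovichTemkinWlodarczyk2024, §5] -/
theorem FDense_end (r : ℚ) (h1 : 1/30 < r) :
    (∀ s : ℚ, 1 - 25 * s < 5 * s ↔ 1/30 < s) ∧ 1 - 25 * r < 5 * r ∧ 1/5 < 6 * r := by
  refine ⟨fun s => ⟨fun h => by linarith, fun h => by linarith⟩, by linarith, by linarith⟩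

/-- **(vi) hypotheses of the cited lemmas at general `r` in the interval**, `p = 5`:
Λ₄ (`r > 1/(3(p+5)) = 1/30`, `2p · 3r > 1`); F♯ (`r > 1/(5(p+1)) = 1/30`); T9 D for the class `4r`
(`1/(8r) < 4 < p`); degree `6` at `5/144` (`5 · (5/24) > 1`, `6 − 1 < 15`). (derived here)
[cite: AbramovichTemkinWlodarczyk2024, §5] -/
theorem cited_hypotheses (r : ℚ) (h1 : 1/30 < r) :
    (1 : ℚ) / (3 * (5 + 5)) < r ∧ 1 < 2 * 5 * (3 * r) ∧ (1 : ℚ) / (5 * (5 + 1)) < r ∧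
      (1 / (8 * r) < 4 ∧ (4 : ℕ) < 5) ∧ ((1 : ℚ) < 5 * (5/24) ∧ (6 : ℕ) - 1 < 15) := by
  have hr : 0 < r := by linarith
  refine ⟨by norm_num; linarith, by linarith, by norm_num; linarith, ⟨?_, by norm_num⟩,
    ⟨by norm_num, by norm_num⟩⟩
  rw [div_lt_iff₀ (by positivity)]
  linarith

end Interval30

end Literature.AlgebraicGeometry.Resolution.WeightedBlowup
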